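import Summits.Ventures.PercRepro.C025ProfileStarBigGeom
/-!
# THE RULE `E*_u` ON THE RANK-`u` SETS WITH `≥ u + 2` POINTS — `(Cap)` for `u ≥ 5`, and `CapStarDep` REDUCES TO THE
NULLITY-ONE SETS (night-3 g11)
`proofs/NIGHT3-G11-ESTAR.md` §8. A payer `B` of such a set (`C025ProfileStarBigGeom`) has `|G_B| ≥ C(R−2, u−2)` — `F_B`
contains `R − 2` points independent over `B` (the extension lemma), all of whose `(u−2)`-subsets are good
(`choose_le_card_Gfam`) — and price `≤ C(R, u−2)/C(u,2)`, so its share is at most `σ(R,u) := C(R,u−2)/(C(u,2)·C(R−2,u−2))`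
(`share_le_sigma`); with at most two payers and `2·C(R,u−2) ≤ C(u,2)·C(R−2,u−2)` for `u ≥ 5`, `R ≥ u + 1`
(`two_mul_choose_le`, equality at `(u,R) = (5,6)`), the load is `≤ 1` (`cap_wEstar_of_big`). Hence, for `u ≥ 5`,
`CapStarDep` (the one open statement of the row `(2,u)` and of its Hall form) holds as soon as every rank-`u` set with
EXACTLY `u + 1` points receives `≤ 1` (`capStarDep_of_nullity_one`).
-/
open scoped Matroid
namespace PercRepro
open Set Finset ThmH
namespace EStar
variable {α : Type} [DecidableEq α] {M : Matroid α} [M.Finite] {u : ℕ}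

/-! ## The share bound -/

/-- `|G_B| ≥ C(R − 2, u − 2)`: `F_B` contains `R − 2` points independent over `B`, and every `(u−2)`-subset of them is
a good set. -/
theorem choose_le_card_Gfam {R : ℕ} (hR : M.eRank = (R : ℕ∞)) (hu : 2 ≤ u) (huR : u ≤ R) {B : Finset α}
    (hB : B ∈ Profile.Rq M 2) : Nat.choose (R - 2) (u - 2) ≤ (Gfam M u B).card := by
  obtain ⟨hBg, hB2⟩ := Profile.mem_Rq.1 hB
  have hspan : (R : ℕ∞) ≤ M.eRk ((B ∪ Fs M B : Finset α) : Set α) := by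
    rw [← hR]; exact eRank_le_eRk_union_Fs hBg
  have hcast : ((2 : ℕ) : ℕ∞) + ((R - 2 : ℕ) : ℕ∞) = (R : ℕ∞) := by
    rw [← Nat.cast_add]; congr 1; omega
  obtain ⟨D, hDF, hDc, hDr⟩ := exists_subset_card_eRk_add hBg (Fs_subset_gr B) (R - 2) (by rw [hB2, hcast]; exact hspan)
  rw [hB2, hcast] at hDr
  have hBDg : B ∪ D ⊆ gr M := Finset.union_subset hBg (hDF.trans (Fs_subset_gr B))
  have hrBD : rkN M (B ∪ D) = R := by unfold rkN; rw [hDr, ENat.toNat_coe]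
  have hsub : D.powersetCard (u - 2) ⊆ Gfam M u B := by
    intro Y hY
    rw [Finset.mem_powersetCard] at hY
    refine mem_Gfam.2 ⟨hY.1.trans hDF, hY.2, ?_⟩
    -- upper bound `ρ(B ∪ Y) ≤ 2 + |Y| = u`
    have hup : rkN M (B ∪ Y) ≤ u := by
      have h1 : M.eRk ((B ∪ Y : Finset α) : Set α) ≤ M.eRk (B : Set α) + M.eRk (Y : Set α) := by
        rw [Finset.coe_union]; exact M.eRk_union_le_eRk_add_eRk _ _
      have h2 : M.eRk (Y : Set α) ≤ ((u - 2 : ℕ) : ℕ∞) := by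
        refine (M.eRk_le_encard _).trans ?_; rw [Set.encard_coe_eq_coe_finsetCard, hY.2]
      have h3 : M.eRk ((B ∪ Y : Finset α) : Set α) ≤ (u : ℕ∞) := by
        refine h1.trans ?_
        rw [hB2]
        calc ((2 : ℕ) : ℕ∞) + M.eRk (Y : Set α) ≤ ((2 : ℕ) : ℕ∞) + ((u - 2 : ℕ) : ℕ∞) := add_le_add (le_refl _) h2
          _ = (u : ℕ∞) := by rw [← Nat.cast_add]; congr 1; omega
      rw [← coe_rkN] at h3
      exact_mod_cast h3
    -- lower bound `R = ρ(B ∪ D) ≤ ρ(B ∪ Y) + |D ∖ Y|`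
    have hlow : R ≤ rkN M (B ∪ Y) + (R - u) := by
      have h1 := rkN_le_rkN_add_card_sdiff (M := M) (B ∪ D) (B ∪ Y)
      have h2 : (B ∪ D) \ (B ∪ Y) ⊆ D \ Y := by
        intro x hx; rw [Finset.mem_sdiff, Finset.mem_union, Finset.mem_union] at hx
        rw [Finset.mem_sdiff]; tauto
      have h3 : ((B ∪ D) \ (B ∪ Y)).card ≤ (D \ Y).card := Finset.card_le_card h2
      rw [Finset.card_sdiff_of_subset hY.1, hDc, hY.2] at h3
      rw [hrBD] at h1
      omega
    have hrk : rkN M (B ∪ Y) = u := by omega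
    unfold rkN at hrk
    rw [← hrk, ENat.coe_toNat (M.isRkFinite_set _).eRk_lt_top.ne]
  calc Nat.choose (R - 2) (u - 2) = (D.powersetCard (u - 2)).card := by rw [Finset.card_powersetCard, hDc]
    _ ≤ (Gfam M u B).card := Finset.card_le_card hsub

/-- The fat share of a payer is at most `σ(R,u) = C(R,u−2)/(C(u,2)·C(R−2,u−2))`. -/
theorem share_le_sigma {R : ℕ} (hR : M.eRank = (R : ℕ∞)) (hu : 2 ≤ u) (huR : u ≤ R) {S B : Finset α}
    (hB : B ∈ payers M u S) :
    Profile.price M 2 u B / ((Gfam M u B ∪ Pfam M u B).card : ℚ) ≤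
      (Nat.choose R (u - 2) : ℚ) / ((Nat.choose u 2 : ℚ) * (Nat.choose (R - 2) (u - 2) : ℚ)) := by
  obtain ⟨hBR, -, -, hcrk, -⟩ := mem_payers.1 hB
  have hG := choose_le_card_Gfam hR hu huR hBR
  have hGP : (Gfam M u B).card ≤ (Gfam M u B ∪ Pfam M u B).card := Finset.card_le_card Finset.subset_union_left
  have hchpos : 0 < Nat.choose (R - 2) (u - 2) := Nat.choose_pos (by omega)
  have hc2 : (0 : ℚ) < (Nat.choose u 2 : ℚ) := by exact_mod_cast Nat.choose_pos hu
  have hcR : (0 : ℚ) < (Nat.choose (R - 2) (u - 2) : ℚ) := by exact_mod_cast hchpos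
  have hcard : (0 : ℚ) < ((Gfam M u B ∪ Pfam M u B).card : ℚ) := by exact_mod_cast (lt_of_lt_of_le hchpos (hG.trans hGP))
  have hpm := price_mul_choose_eq (M := M) hu hcrk
  have hcrkR : crk M B ≤ R := crk_le_of_eRank hR B
  have hprice : Profile.price M 2 u B ≤ (Nat.choose R (u - 2) : ℚ) / (Nat.choose u 2 : ℚ) := by
    rw [le_div_iff₀ hc2, hpm]
    exact_mod_cast Nat.choose_le_choose (u - 2) hcrkR
  have hpn := Profile.price_nonneg (M := M) 2 u B
  calc Profile.price M 2 u B / ((Gfam M u B ∪ Pfam M u B).card : ℚ)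
      ≤ Profile.price M 2 u B / (Nat.choose (R - 2) (u - 2) : ℚ) :=
        div_le_div_of_nonneg_left hpn hcR (by exact_mod_cast hG.trans hGP)
    _ ≤ ((Nat.choose R (u - 2) : ℚ) / (Nat.choose u 2 : ℚ)) / (Nat.choose (R - 2) (u - 2) : ℚ) :=
        div_le_div_of_nonneg_right hprice hcR.le
    _ = (Nat.choose R (u - 2) : ℚ) / ((Nat.choose u 2 : ℚ) * (Nat.choose (R - 2) (u - 2) : ℚ)) := by
        rw [div_div]

/-! ## The arithmetic: `2·C(R, u−2) ≤ C(u,2)·C(R−2, u−2)` for `u ≥ 5`, `R ≥ u + 1` -/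

/-- The polynomial inequality behind the share bound (`k = u − 4 ≥ 1`, `d = R − u − 1 ≥ 0`). -/
theorem poly_ineq (k d : ℕ) (hk : 1 ≤ k) :
    4 * ((d + 2) * (d + 3)) + 8 * ((k + 2) * (d + 3)) + 4 * ((k + 2) * (k + 1)) ≤
      (k + 4) * (k + 3) * ((d + 2) * (d + 3)) := by
  nlinarith [Nat.zero_le (d * d * k), Nat.zero_le (d * k * k), Nat.zero_le (d * d), Nat.zero_le (d * k),
    Nat.zero_le (k * k), Nat.zero_le d, Nat.mul_le_mul_right (k + 4) hk]

/-- `2·C(n+2, k+2) ≤ C(k+4, 2)·C(n, k+2)` for `k ≥ 1` and `n ≥ k + 3` (Pascal twice and the ratio identities). -/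
theorem two_mul_choose_le_aux (n k : ℕ) (hk : 1 ≤ k) (hn : k + 3 ≤ n) :
    2 * Nat.choose (n + 2) (k + 2) ≤ Nat.choose (k + 4) 2 * Nat.choose n (k + 2) := by
  -- Pascal twice
  have hP : Nat.choose (n + 2) (k + 2) = Nat.choose n k + 2 * Nat.choose n (k + 1) + Nat.choose n (k + 2) := by
    rw [Nat.choose_succ_succ, Nat.choose_succ_succ, Nat.choose_succ_succ]; ring
  -- the ratio identities
  have r1 := Nat.choose_succ_right_eq n (k + 1)
  have r2 := Nat.choose_succ_right_eq n k
  -- `C(k+4, 2) = (k+4)(k+3)/2`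
  have hC : Nat.choose (k + 4) 2 * 2 = (k + 4) * (k + 3) := by
    rw [Nat.choose_two_right, show k + 4 - 1 = k + 3 by omega, mul_comm (k + 4) (k + 3)]
    exact Nat.div_mul_cancel (even_iff_two_dvd.1 (Nat.even_mul_succ_self (k + 3)))
  set a := Nat.choose n (k + 2) with ha
  set b := Nat.choose n (k + 1) with hb
  set c := Nat.choose n k with hc
  obtain ⟨d, hd⟩ : ∃ d, n = k + 3 + d := ⟨n - (k + 3), by omega⟩
  subst hd
  have r1' : a * (k + 2) = b * (d + 2) := by
    rw [ha, hb]; have := r1; rw [show k + 3 + d - (k + 1) = d + 2 by omega] at this; exact this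
  have r2' : b * (k + 1) = c * (d + 3) := by
    rw [hb, hc]; have := r2; rw [show k + 3 + d - k = d + 3 by omega] at this; exact this
  have hpoly := poly_ineq k d hk
  -- multiply the target by `2 (d+2)(d+3)` and substitute
  have hapos : 0 < a := by rw [ha]; exact Nat.choose_pos (by omega)
  rw [hP]
  -- goal: 2 (c + 2 b + a) ≤ C(k+4,2) a
  suffices h : 2 * (c + 2 * b + a) * (2 * ((d + 2) * (d + 3))) ≤ Nat.choose (k + 4) 2 * a * (2 * ((d + 2) * (d + 3))) by
    exact Nat.le_of_mul_le_mul_right h (by positivity)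
  have e1 : b * (2 * ((d + 2) * (d + 3))) = a * (k + 2) * (2 * (d + 3)) := by
    calc b * (2 * ((d + 2) * (d + 3))) = (b * (d + 2)) * (2 * (d + 3)) := by ring
      _ = a * (k + 2) * (2 * (d + 3)) := by rw [← r1']
  have e2 : c * (2 * ((d + 2) * (d + 3))) = a * (k + 2) * (k + 1) * 2 := by
    calc c * (2 * ((d + 2) * (d + 3))) = (c * (d + 3)) * (2 * (d + 2)) := by ring
      _ = (b * (k + 1)) * (2 * (d + 2)) := by rw [← r2']
      _ = (b * (d + 2)) * (k + 1) * 2 := by ring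
      _ = a * (k + 2) * (k + 1) * 2 := by rw [← r1']
  have e3 : Nat.choose (k + 4) 2 * a * (2 * ((d + 2) * (d + 3))) = a * ((k + 4) * (k + 3) * ((d + 2) * (d + 3))) := by
    calc Nat.choose (k + 4) 2 * a * (2 * ((d + 2) * (d + 3))) = (Nat.choose (k + 4) 2 * 2) * a * ((d + 2) * (d + 3)) := by ring
      _ = a * ((k + 4) * (k + 3) * ((d + 2) * (d + 3))) := by rw [hC]; ring
  calc 2 * (c + 2 * b + a) * (2 * ((d + 2) * (d + 3)))
      = 2 * (c * (2 * ((d + 2) * (d + 3)))) + 4 * (b * (2 * ((d + 2) * (d + 3)))) + 2 * a * (2 * ((d + 2) * (d + 3))) := by ring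
    _ = a * (4 * ((d + 2) * (d + 3)) + 8 * ((k + 2) * (d + 3)) + 4 * ((k + 2) * (k + 1))) := by rw [e1, e2]; ring
    _ ≤ a * ((k + 4) * (k + 3) * ((d + 2) * (d + 3))) := Nat.mul_le_mul_left a hpoly
    _ = Nat.choose (k + 4) 2 * a * (2 * ((d + 2) * (d + 3))) := e3.symm

/-- `2·C(R, u−2) ≤ C(u,2)·C(R−2, u−2)` for `u ≥ 5` and `R ≥ u + 1`. -/
theorem two_mul_choose_le {R : ℕ} (hu : 5 ≤ u) (hR : u + 1 ≤ R) :
    2 * Nat.choose R (u - 2) ≤ Nat.choose u 2 * Nat.choose (R - 2) (u - 2) := by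
  obtain ⟨k, rfl⟩ : ∃ k, u = k + 4 := ⟨u - 4, by omega⟩
  obtain ⟨n, rfl⟩ : ∃ n, R = n + 2 := ⟨R - 2, by omega⟩
  have h := two_mul_choose_le_aux n k (by omega) (by omega)
  rw [show k + 4 - 2 = k + 2 by omega, show n + 2 - 2 = n by omega]
  exact h

/-! ## `(Cap)` on the big sets and the reduction of `CapStarDep` to nullity one -/

/-- **`(Cap)` of `E*_u` on every rank-`u` set with `≥ u + 2` points** (`u ≥ 5`, simple, rank `≥ u + 1`). -/
theorem cap_wEstar_of_big (hsimple : ∀ T ⊆ M.E, T.encard ≤ 2 → M.Indep T) (hu : 5 ≤ u)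
    (hR : (u : ℕ∞) + 1 ≤ M.eRank) {S : Finset α} (hS : S ∈ Shadow.levelSet M u) (hc : u + 2 ≤ S.card) :
    ∑ B ∈ (Profile.Rq M 2).filter (fun B => B ⊆ S), wEstar M u B S ≤ 1 := by
  have hRtop : M.eRank ≠ ⊤ := M.eRank_ne_top_iff.2 inferInstance
  obtain ⟨R, hRe⟩ := ENat.ne_top_iff_exists.1 hRtop
  have hRe' : M.eRank = (R : ℕ∞) := hRe.symm
  have huR : u + 1 ≤ R := by
    have : ((u + 1 : ℕ) : ℕ∞) ≤ (R : ℕ∞) := by rw [Nat.cast_succ, ← hRe']; exact hR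
    exact_mod_cast this
  rw [sum_wEstar_eq_sum_payers (by omega) hc]
  set σ : ℚ := (Nat.choose R (u - 2) : ℚ) / ((Nat.choose u 2 : ℚ) * (Nat.choose (R - 2) (u - 2) : ℚ)) with hσ
  have hshare : ∀ B ∈ payers M u S, Profile.price M 2 u B / ((Gfam M u B ∪ Pfam M u B).card : ℚ) ≤ σ :=
    fun B hB => share_le_sigma hRe' (by omega) (by omega) hB
  have hσhalf : σ ≤ 1 / 2 := by
    rw [hσ]
    have hpos : (0 : ℚ) < (Nat.choose u 2 : ℚ) * (Nat.choose (R - 2) (u - 2) : ℚ) := by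
      have h1 : 0 < Nat.choose u 2 := Nat.choose_pos (by omega)
      have h2 : 0 < Nat.choose (R - 2) (u - 2) := Nat.choose_pos (by omega)
      positivity
    rw [div_le_iff₀ hpos]
    have h := two_mul_choose_le (R := R) hu huR
    have h' : (2 : ℚ) * (Nat.choose R (u - 2) : ℚ) ≤ (Nat.choose u 2 : ℚ) * (Nat.choose (R - 2) (u - 2) : ℚ) := by
      exact_mod_cast h
    linarith
  have hcount := card_payers_le_two hsimple hS hc
  have hσnn : 0 ≤ σ := by rw [hσ]; positivity
  calc ∑ B ∈ payers M u S, Profile.price M 2 u B / ((Gfam M u B ∪ Pfam M u B).card : ℚ)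
      ≤ ∑ _B ∈ payers M u S, σ := Finset.sum_le_sum hshare
    _ = ((payers M u S).card : ℚ) * σ := by rw [Finset.sum_const, nsmul_eq_mul]
    _ ≤ 2 * σ := by
        apply mul_le_mul_of_nonneg_right _ hσnn
        exact_mod_cast hcount
    _ ≤ 1 := by linarith

/-- **For `u ≥ 5`, `CapStarDep` reduces to the sets with exactly `u + 1` points** (nullity one). -/
theorem capStarDep_of_nullity_one (hsimple : ∀ T ⊆ M.E, T.encard ≤ 2 → M.Indep T) (hu : 5 ≤ u)
    (hR : (u : ℕ∞) + 1 ≤ M.eRank)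
    (h : ∀ S ∈ Shadow.levelSet M u, S.card = u + 1 →
      ∑ B ∈ (Profile.Rq M 2).filter (fun B => B ⊆ S), wEstar M u B S ≤ 1) : CapStarDep M u := by
  intro S hS hlt
  rcases Nat.lt_or_ge (S.card) (u + 2) with hsmall | hbig
  · exact h S hS (by omega)
  · exact cap_wEstar_of_big hsimple hu hR hS hbig

end EStar
end PercRepro
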